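/-
Copyright (c) 2026 the pub-hodgecm-mathlib formalisation cell (harness21).  R90-TF SLAB, section S10 (Rogawski 1990, Ch. 13.8), prover R90-C138-p01 (g0):
the HEAD of the (U3-ξ) socket `sock_S10_auxGlobaliseTorus : AuxGlobaliseTorusLetter` of FILE U (`Cruxes/H413/Lines/R90_S10_LocalGlobaliseU.lean`);
h413 = `stmt-HodgeConjecture-24833`, route `HCCMUnconditional`.
-/
import Summits.HodgeConjecture.HodgeConjecture.Theorems.R90S10LocalGlobaliseUDefs      -- ★ p863100: `R90.S10.AuxGlobaliseTorusLetter` (the socket TYPE)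
import Summits.HodgeConjecture.HodgeConjecture.Theorems.R90S10TorusCharGlobalise       -- ★ p863149: `R90.S10.auxGlobaliseTorus` (its body, proved)
import HarnessLib

/-!
# R90-TF ∕ S10 — `auxGlobaliseTorusLetter_holds : AuxGlobaliseTorusLetter` (the (U3-ξ) letter of FILE U HOLDS)

Cell hodgecm-mathlib, slab R90-TF, section S10 = [Rogawski1990] §13.8, crux item h413 = `stmt-HodgeConjecture-24833`; kernel lane
`--kind proof --supports stmt-HodgeConjecture-24833 --as helper`; THEOREMS ONLY; LAW L9 «DEFS DOWN» (no `Cruxes/…/Lines` import).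

The (U3-ξ) letter ★ `R90.S10.AuxGlobaliseTorusLetter` (`Theorems/R90S10LocalGlobaliseUDefs.lean` :110–:128: «along S3's local-transport datum
`(Φ, hc, hc′, hΦσ)` towards a NON-SPLIT `v′`, the local components `η_v, ψ_v` of the torus characters of `ξ` are the `v′`-components, read
through `Units.map Φ`, of SOME one-dimensional automorphic `ξ′` of `H′(𝔸_{L′⁺})`») is its body ★ `R90.S10.auxGlobaliseTorus`
(`Theorems/R90S10TorusCharGlobalise.lean`, proved from ★ `exists_isConjugateSymplectic_semilocalComponent_eq`, the Hilbert-90 torus dictionary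
★ `TorusDict.exists_pullback_eq`, ★ `cm_pullback_semilocalComponent`, ★ `exists_quotConj_eq_of_nonsplit` and ★ `OneDimAutRepH.ofAutomorphic`)
— by `δ`-unfolding the definition (`Pl L` is the `abbrev` `HeightOneSpectrum (𝓞 L⁺)`).  The Lines file pays its socket BY NAME:
`sock_S10_auxGlobaliseTorus := R90.S10.auxGlobaliseTorusLetter_holds`.

HONEST LABEL: a helper ★ pays no socket until the Lines edition names it; HC_CM is proved only modulo the 7 printed citations (2 remaining named
inputs: hLiu418 = `stmt-HodgeConjecture-24832`, h413 = `stmt-HodgeConjecture-24833`) until rung 0 closes; REL ≠ ★ ≠ BUILT.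

## References
* [Rogawski1990] J. Rogawski, *Automorphic Representations of Unitary Groups in Three Variables*, Ann. of Math. Stud. 123 (1990), §13.8 p. 217 l. 9–12.
-/

set_option autoImplicit false
set_option linter.dupNamespace false

namespace Summit.HodgeConjecture.HodgeConjecture.R90.S10

/-- **THE (U3-ξ) LETTER HOLDS**: `AuxGlobaliseTorusLetter` — globalisation of the torus characters `η_v, ψ_v` of `ξ` along S3's local-transport
datum towards a non-split `v′` («every character of `Π′𝒪_v^1` extends to a character of `E^1\E^1_𝔸` … `φ_w = φ′`»); the body is ★ `auxGlobaliseTorus`.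
[cite: Rogawski1990, §13.8 p. 217 l. 9–12] -/
theorem auxGlobaliseTorusLetter_holds : AuxGlobaliseTorusLetter := auxGlobaliseTorus

end Summit.HodgeConjecture.HodgeConjecture.R90.S10
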